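import Literature.NumberTheory.GaloisCohomology.Howard2004.TowerSelmerShaTwoObstructionProofs
import Literature.NumberTheory.GaloisCohomology.Howard2004.ResidualShaTwoVanishingProofs
import Literature.NumberTheory.GaloisCohomology.Howard2004.ResidualShaOneVanishingProofs
import HarnessLib

/-!
# Howard 2004, Prop. 1.4.1 — EVERY `𝓕(n)`-Selmer class of `T^{(t)}` lifts to a GLOBAL class of `T^{(t+1)}`
# (the `Ш²`-obstruction vanishes identically under H.0–H.5) — proofs file

Topic `NumberTheory/GaloisCohomology/Howard2004`. THEOREMS ONLY: no definition, no named fact, no instance, no notation,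
no `sorry`.  Cell `pub/bsd-print-x9` (seat x10b-p1-w8 g12, brick «C451-CL Q1 GLOBAL-LIFT» of LEAD g14's class-level port plan
2026-08-29T14:13Z, `--supports stmt-BirchSwinnertonDyer-22642`; print leaf G87 ↦ the «Flach leaf» C45.1′ / C45.1″).
COMPOSITION of three kernel bricks: x10b-p1-w2 g18's `Ш²`-step (`TowerSelmerShaTwoObstructionProofs`: the obstruction
`δ₁ a` of an `𝓕(n)`-Selmer class lies in `Ш²(K, T^{(0)})`, and `a` lifts iff `δ₁ a = 0`), this seat's `Ш¹(K, T̄) = 0`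
(`ResidualShaOneVanishingProofs`, H.2 + Lemma 1.6.2) and its H.4/Poitou–Tate transport `Ш²(K, T^{(0)}) = 0`
(`ResidualShaTwoVanishingProofs`).

SOURCE. B. Howard, *The Heegner point Kolyvagin system*, Compositio Math. **140** (2004) = arXiv:1202.6340, Prop. 1.4.1 and §1.4
display (2) (p0008 L22–30, L83–98); M. Flach, J. reine angew. Math. **412** (1990), proof of Thm. 1 (the `Ш²`-step of the kernel
computation); J. S. Milne, *Arithmetic Duality Theorems*, I Thm. 4.10 (a).

WHAT IS PROVED (a `DVRSetting` `S` with H.0–H.5; Čebotarev `hC`, `hp0 : (p : R) ≠ 0`, `hL : S.LargePrimes`, `hu : p ∤ #𝓞_K^×`;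
Poitou–Tate (b) `hST : poitouTate_sha_tateDual K` (kernel Summits-side); bottom level `e_0 = 1`).
* **`exists_redLEH1_eq_of_mem_selmerGroup_atLevel_of_isSES`** — for ANY presentation `0 → T^{(0)} →f T^{(t+1)} →g T^{(i)} → 0`
  (`IsSES f g`, `g = redLE` on elements), `n ⊆ 𝓛^{(t+1)}`: every `a ∈ H¹_{𝓕(n)}(K, T^{(i)})` is `H¹(red) c` for a GLOBAL
  `c ∈ H¹(K, T^{(t+1)})` — `δ₁ a ∈ Ш²(K, T^{(0)}) = 0`.
* **`exists_redLEH1_eq_of_mem_selmerGroup_atLevel`** — the same with the presentation supplied by the tree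
  (`exists_linearMap_comp_redLE_eq`, `injective_of_comp_redLE_eq`, `redLE_eq_zero_iff_mem_range_of_comp_redLE_eq`) for the
  one-step reduction `T^{(t+1)} ↠ T^{(t)}` of a FULL setting (`e_j = j + 1`): **every `a ∈ H¹_{𝓕(n)}(K, T^{(t)})` lifts to
  `H¹(K, T^{(t+1)})`.**
* §2 **`exists_redLEH1_eq_of_mem_selmerGroup_atLevel_of_isSES_of_shaTwo`**, **`exists_redLEH1_eq_of_mem_selmerGroup_atLevel_of_shaTwo`**
  — the SOURCE-AGNOSTIC forms: the same conclusions from `hy`, `hu` and the single hypothesis `hsha2 : shaTwo (S.T.ρ 0) = ⊥`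
  (no Čebotarev / `(p : R) ≠ 0` / `LargePrimes` / Poitou–Tate binder; `Γ_K` compact by the tree's instance theorem).

READING.  With this, the hypothesis «`a` has a global lift `ã`» of `TowerSelmerLiftGlobalDualityProofs` (LIFT-PT) and
`TowerSelmerLiftPairingWellDefinedProofs` (LIFT-WD) holds for EVERY Selmer class: the left-kernel theory of the C45.1″ port is
class-level on all of `𝓗_t(n)`.

HONEST FRAMING: Prop. 1.4.1, C45.1′/C45.1″ and `thm161_dvrKolyvaginBound` are NOT proved; no summit statement is proved; the
Birch–Swinnerton-Dyer conjecture is not proved by any of this.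
-/

set_option autoImplicit false

noncomputable section

namespace Literature.NumberTheory.GaloisCohomology.Howard2004

open Function NumberField IsDedekindDomain Field CategoryTheory
open scoped NumberField ContRepresentation
open Literature.NumberTheory.GaloisRepresentations
open Literature.NumberTheory.GaloisRepresentations.DiscreteGaloisModule

namespace DVRSetting

variable {p : ℕ} [Fact p.Prime] {K : Type} [Field K] [NumberField K]
  {R : Type} [CommRing R] [IsDomain R] [IsDiscreteValuationRing R] [Algebra ℤ_[p] R]
  {N : ℕ → Type} [∀ k, AddCommGroup (N k)] [∀ k, TopologicalSpace (N k)]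
  [∀ k, DiscreteTopology (N k)] [∀ k, Module R (N k)]
  {Rk : ℕ → Type} [∀ k, CommRing (Rk k)] [∀ k, IsLocalRing (Rk k)] [∀ k, TopologicalSpace (Rk k)]
  [∀ k, DiscreteTopology (Rk k)] [∀ k, Algebra ℤ_[p] (Rk k)] [∀ k, Algebra R (Rk k)]
  [∀ k, Module (Rk k) (N k)] [∀ k, IsScalarTower R (Rk k) (N k)]
  {Nbar : Type} [AddCommGroup Nbar] [TopologicalSpace Nbar] [DiscreteTopology Nbar]
  [∀ k, Module (Rk k) Nbar]
  {Nq : ℕ → Finset (HeightOneSpectrum (𝓞 K)) → Type} [∀ k n, AddCommGroup (Nq k n)]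
  [∀ k n, TopologicalSpace (Nq k n)] [∀ k n, DiscreteTopology (Nq k n)]
  [∀ k n, Module (Rk k) (Nq k n)] [∀ k n, Module R (Nq k n)]
  [∀ k n, IsScalarTower R (Rk k) (Nq k n)]

/-- **EVERY `𝓕(n)`-Selmer class lifts globally (given a presentation of the reduction).**  On a `DVRSetting` with H.0–H.5
(Čebotarev, `(p : R) ≠ 0`, `𝓛_s ⊆ 𝓛` for `s ≫ 0`, `p ∤ #𝓞_K^×`, bottom exponent `e_0 = 1`) and Poitou–Tate duality (b), for any
short exact sequence `0 → T^{(0)} →f T^{(t+1)} →g T^{(i)} → 0` of the levels with `g = redLE` and `n ⊆ 𝓛^{(t+1)}`: every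
`a ∈ H¹_{𝓕(n)}(K, T^{(i)})` is `H¹(red) c` for some GLOBAL `c ∈ H¹(K, T^{(t+1)})` — its obstruction `δ₁ a` lies in
`Ш²(K, T^{(0)})` (x10b-p1-w2 g18), which vanishes (`Ш¹(K, T̄) = 0` by H.2 + Lemma 1.6.2, transported to `Ш¹(K, T^{(0)*}) = 0` by
H.1/H.4/H.5 and dualised by Poitou–Tate).
[cite: Howard2004HeegnerKolyvagin, Prop. 1.4.1 and §1.4 display (2) (arXiv:1202.6340 p0008 L22–30, L83–98), H.2 and Lemma 1.6.2 (p. 7 L61–63, p. 11 L30–58)]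
[cite: Flach1990, proof of Thm. 1 (the Ш²-step)] [cite: MilneADT2006, Ch. I, Thm. 4.10 (a)] -/
theorem exists_redLEH1_eq_of_mem_selmerGroup_atLevel_of_isSES [Finite Nbar] [∀ k, Finite (N k)]
    [CompactSpace (absoluteGaloisGroup K)]
    (S : DVRSetting p K R N Rk Nbar Nq) (hy : S.SatisfiesH) (hC : Automorphic.chebotarev_artinRep)
    (hp0 : ((p : ℕ) : R) ≠ 0) (hL : S.LargePrimes) (hu : ¬ p ∣ Nat.card (𝓞 K)ˣ) (he0 : S.e 0 = 1)
    (hST : poitouTate_sha_tateDual K)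
    {i t : ℕ} (hit : i ≤ t + 1) {n : Finset (HeightOneSpectrum (𝓞 K))} (hn : ↑n ⊆ S.levelPrimes (t + 1))
    {f : (S.T.ρ 0).toTopRep ⟶ (S.T.ρ (t + 1)).toTopRep} {g : (S.T.ρ (t + 1)).toTopRep ⟶ (S.T.ρ i).toTopRep}
    (h : IsSES f g) (hg : ∀ y, g.hom y = S.T.redLE hit y)
    {a : galoisCohomology (S.T.ρ i) 1} (ha : a ∈ (((S.t i).atLevel S.jbar n).cond).selmerGroup) :
    ∃ c : galoisCohomology (S.T.ρ (t + 1)) 1, S.redLEH1 hit c = a := by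
  rw [S.exists_redLEH1_eq_iff_δ₁_eq_zero hit h hg a]
  have hmem := S.δ₁_mem_shaTwo_of_mem_selmerGroup_atLevel hy hu hit hn h hg ha
  rw [S.shaTwo_level_zero_eq_bot_of_sha_rhobar hy he0 hST (S.sha_rhobar_eq_bot hy hC hp0 hL)] at hmem
  exact AddSubgroup.mem_bot.1 hmem

/-- **EVERY `𝓕(n)`-Selmer class of `T^{(t)}` lifts to a GLOBAL class of `T^{(t+1)}`** on a FULL `DVRSetting`
(`e_j = j + 1`) with H.0–H.5 (Čebotarev, `(p : R) ≠ 0`, `𝓛_s ⊆ 𝓛` for `s ≫ 0`, `p ∤ #𝓞_K^×`) and Poitou–Tate duality (b):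
for `n ⊆ 𝓛^{(t+1)}` and `a ∈ H¹_{𝓕(n)}(K, T^{(t)})` there is `c ∈ H¹(K, T^{(t+1)})` with `H¹(red) c = a` — the presentation
`0 → T^{(0)} →ι T^{(t+1)} →red T^{(t)} → 0` being the tree's (`exists_linearMap_comp_redLE_eq`; exact since `e_0 + e_t = e_{t+1}`).
So the hypothesis «`a` has a global lift» of LIFT-PT / LIFT-WD holds for every Selmer class.
[cite: Howard2004HeegnerKolyvagin, Prop. 1.4.1 (arXiv:1202.6340 p0008 L83–98), H.2 and Lemma 1.6.2]
[cite: Flach1990, proof of Thm. 1 (the Ш²-step)] [cite: MilneADT2006, Ch. I, Thm. 4.10 (a)] -/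
theorem exists_redLEH1_eq_of_mem_selmerGroup_atLevel [Finite Nbar] [∀ k, Finite (N k)]
    [CompactSpace (absoluteGaloisGroup K)]
    (S : DVRSetting p K R N Rk Nbar Nq) (hy : S.SatisfiesH) (hC : Automorphic.chebotarev_artinRep)
    (hp0 : ((p : ℕ) : R) ≠ 0) (hL : S.LargePrimes) (hu : ¬ p ∣ Nat.card (𝓞 K)ˣ) (hfull : ∀ j, S.e j = j + 1)
    (hST : poitouTate_sha_tateDual K)
    (t : ℕ) {n : Finset (HeightOneSpectrum (𝓞 K))} (hn : ↑n ⊆ S.levelPrimes (t + 1))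
    {a : galoisCohomology (S.T.ρ t) 1} (ha : a ∈ (((S.t t).atLevel S.jbar n).cond).selmerGroup) :
    ∃ c : galoisCohomology (S.T.ρ (t + 1)) 1, S.redLEH1 (Nat.le_succ t) c = a := by
  have hπm : S.π ∈ IsLocalRing.maximalIdeal R := by rw [hy.unif]; exact Ideal.mem_span_singleton_self _
  have hle : ∀ k, S.e k ≤ S.e (k + 1) := fun k => hy.e_strictMono.monotone (Nat.le_succ k)
  obtain ⟨ι, hιg, hι⟩ := S.exists_linearMap_comp_redLE_eq hy hπm hle (Nat.zero_le (t + 1))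
  have he : S.e 0 + S.e t = S.e (t + 1) := by rw [hfull, hfull, hfull]; omega
  exact S.exists_redLEH1_eq_of_mem_selmerGroup_atLevel_of_isSES hy hC hp0 hL hu (hfull 0) hST (Nat.le_succ t) hn
    (S.isSES_of_comp_redLE_eq hy (Nat.zero_le (t + 1)) (Nat.le_succ t) he ι hιg hι) (fun _ => rfl) ha

/-! ## §2 Source-agnostic form: the global lift from `Ш²(K, T^{(0)}) = 0` as a HYPOTHESIS

The two theorems above bake in ONE proof of `Ш²(K, T^{(0)}) = 0` (Čebotarev + `(p : R) ≠ 0` + `LargePrimes`, then H.4 +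
Poitou–Tate).  The class-level port of Prop. 1.4.1 in its print-intended strength has no `LargePrimes` hypothesis, so the
lift is restated with `Ш²(K, T^{(0)}) = 0` as an explicit hypothesis `hsha2`, to be discharged by whichever vanishing theorem
the caller holds; no Čebotarev / `(p : R) ≠ 0` / `LargePrimes` / Poitou–Tate binder remains, and the compactness of `Γ_K`
(needed by the connecting map inside the proof) is discharged by the tree's instance theorem rather than bound. -/

/-- **EVERY `𝓕(n)`-Selmer class lifts globally, given a presentation of the reduction and `Ш²(K, T^{(0)}) = 0`.**  On a
`DVRSetting` with H.0–H.5 and `p ∤ #𝓞_K^×`, for any short exact sequence `0 → T^{(0)} →f T^{(t+1)} →g T^{(i)} → 0` of the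
levels with `g = redLE` and `n ⊆ 𝓛^{(t+1)}`: if `Ш²(K, T^{(0)}) = 0` then every `a ∈ H¹_{𝓕(n)}(K, T^{(i)})` is `H¹(red) c`
for some GLOBAL `c ∈ H¹(K, T^{(t+1)})` (its obstruction `δ₁ a ∈ Ш²(K, T^{(0)})` vanishes).
[cite: Howard2004HeegnerKolyvagin, Prop. 1.4.1 and §1.4 display (2) (arXiv:1202.6340 p0008 L22–30, L83–98)]
[cite: Flach1990, proof of Thm. 1 (the Ш²-step)] -/
theorem exists_redLEH1_eq_of_mem_selmerGroup_atLevel_of_isSES_of_shaTwo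
    (S : DVRSetting p K R N Rk Nbar Nq) (hy : S.SatisfiesH) (hu : ¬ p ∣ Nat.card (𝓞 K)ˣ)
    (hsha2 : shaTwo (S.T.ρ 0) = ⊥)
    {i t : ℕ} (hit : i ≤ t + 1) {n : Finset (HeightOneSpectrum (𝓞 K))} (hn : ↑n ⊆ S.levelPrimes (t + 1))
    {f : (S.T.ρ 0).toTopRep ⟶ (S.T.ρ (t + 1)).toTopRep} {g : (S.T.ρ (t + 1)).toTopRep ⟶ (S.T.ρ i).toTopRep}
    (h : IsSES f g) (hg : ∀ y, g.hom y = S.T.redLE hit y)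
    {a : galoisCohomology (S.T.ρ i) 1} (ha : a ∈ (((S.t i).atLevel S.jbar n).cond).selmerGroup) :
    ∃ c : galoisCohomology (S.T.ρ (t + 1)) 1, S.redLEH1 hit c = a := by
  haveI : CompactSpace (absoluteGaloisGroup K) := absoluteGaloisGroup_compactSpace _
  rw [S.exists_redLEH1_eq_iff_δ₁_eq_zero hit h hg a]
  have hmem := S.δ₁_mem_shaTwo_of_mem_selmerGroup_atLevel hy hu hit hn h hg ha
  rw [hsha2] at hmem
  exact AddSubgroup.mem_bot.1 hmem

/-- **EVERY `𝓕(n)`-Selmer class of `T^{(t)}` lifts to a GLOBAL class of `T^{(t+1)}`, given `Ш²(K, T^{(0)}) = 0`**, on a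
FULL `DVRSetting` (`e_j = j + 1`) with H.0–H.5 and `p ∤ #𝓞_K^×`: for `n ⊆ 𝓛^{(t+1)}` and `a ∈ H¹_{𝓕(n)}(K, T^{(t)})` there
is `c ∈ H¹(K, T^{(t+1)})` with `H¹(red) c = a` (presentation `0 → T^{(0)} →ι T^{(t+1)} →red T^{(t)} → 0` from the tree,
exact since `e_0 + e_t = e_{t+1}`).  Source-agnostic form of `exists_redLEH1_eq_of_mem_selmerGroup_atLevel`: no Čebotarev,
`(p : R) ≠ 0`, `LargePrimes` or Poitou–Tate hypothesis — only `hsha2`.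
[cite: Howard2004HeegnerKolyvagin, Prop. 1.4.1 (arXiv:1202.6340 p0008 L83–98)] [cite: Flach1990, proof of Thm. 1 (the Ш²-step)] -/
theorem exists_redLEH1_eq_of_mem_selmerGroup_atLevel_of_shaTwo
    (S : DVRSetting p K R N Rk Nbar Nq) (hy : S.SatisfiesH) (hu : ¬ p ∣ Nat.card (𝓞 K)ˣ) (hfull : ∀ j, S.e j = j + 1)
    (hsha2 : shaTwo (S.T.ρ 0) = ⊥)
    (t : ℕ) {n : Finset (HeightOneSpectrum (𝓞 K))} (hn : ↑n ⊆ S.levelPrimes (t + 1))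
    {a : galoisCohomology (S.T.ρ t) 1} (ha : a ∈ (((S.t t).atLevel S.jbar n).cond).selmerGroup) :
    ∃ c : galoisCohomology (S.T.ρ (t + 1)) 1, S.redLEH1 (Nat.le_succ t) c = a := by
  have hπm : S.π ∈ IsLocalRing.maximalIdeal R := by rw [hy.unif]; exact Ideal.mem_span_singleton_self _
  have hle : ∀ k, S.e k ≤ S.e (k + 1) := fun k => hy.e_strictMono.monotone (Nat.le_succ k)
  obtain ⟨ι, hιg, hι⟩ := S.exists_linearMap_comp_redLE_eq hy hπm hle (Nat.zero_le (t + 1))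
  have he : S.e 0 + S.e t = S.e (t + 1) := by rw [hfull, hfull, hfull]; omega
  exact S.exists_redLEH1_eq_of_mem_selmerGroup_atLevel_of_isSES_of_shaTwo hy hu hsha2 (Nat.le_succ t) hn
    (S.isSES_of_comp_redLE_eq hy (Nat.zero_le (t + 1)) (Nat.le_succ t) he ι hιg hι) (fun _ => rfl) ha

end DVRSetting

end Literature.NumberTheory.GaloisCohomology.Howard2004

end
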